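import Mathlib
import Literature.Computability.AlgebraicComplexity.GroupTheoreticMatMul
import Literature.Computability.AlgebraicComplexity.STPPLineFamilies
import Summits.MatrixMultiplication.MatrixMultiplication.Theorems.AbelianSTPPSieve
import Summits.MatrixMultiplication.MatrixMultiplication.Theorems.AbelianSTPPCensusTEResiduals

/-!
# The `T_D` / `T_B` frontier objects of the abelian STPP census, killed by the second-moment certificate

Support file for route `MatrixMultiplication/GroupTheoreticSTPP`, negative crux
`stmt-MatrixMultiplication-0596` (`CAbelianObstructionNeg`), finite-range evidence; cell mm-stpp, rung F-M1,
HOME/CENSUS-PLAN.md §6.1 (19:20Z/19:42Z lines: the vM sieve's admissible families ABOVE its ceilings) and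
HOME/mm-stpp-lit/KNESER-KILLS.md §4.4.  Instances of `STPPSlack.false_of_certificate_C` (`decide`):
* **Q3.13 = NO**: `{(5,4,4),(4,5,4),(4,4,5),(4,4,4)}` in an abelian group of order 141 (registered OPEN by the
  planner; hand-killed by the lit seat with Kneser) — and the same multiset at order 140 (planner's (‡) kill);
* the `T_D` «ceiling» families at orders 161–166;
* the `T_B` object `{(7,6,6),(6,7,6),(6,6,7),(6,6,6)×3}` at order 450 (planner's Q313-140-KILL §5, REF pending).
All in kernel, Kneser-free; wrappers `NoSTPPSubfamily M L` in the census vocabulary.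

WHAT THIS IS NOT: no `ω` statement; finite instances of a necessary condition; whether these are the ONLY
admissible families at those orders is sieve-lineage data.
-/

-- single-conjunct summit: the mandated namespace repeats `MatrixMultiplication`.
set_option linter.dupNamespace false

namespace Summit.MatrixMultiplication.MatrixMultiplication.Theorems

namespace STPPSlack

open Finset Literature.Computability.AlgebraicComplexity

variable {H : Type*} [AddCommGroup H] [Fintype H]

/-- Q3.13 (T_D, τ = 2.47): order 141, shapes `(5,4,4),(4,5,4),(4,4,5),(4,4,4)`: impossible (`C`-form certificate). [original] -/
theorem noTD_141 {A B C : Fin 4 → Finset H} (h : IsSTPP A B C)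
    (hA : ∀ r, (A r).card = ![5, 4, 4, 4] r) (hB : ∀ r, (B r).card = ![4, 5, 4, 4] r)
    (hC : ∀ r, (C r).card = ![4, 4, 5, 4] r) (hM : Fintype.card H = 141) : False :=
  false_of_certificate_C h hA hB hC (by decide) hM (m := 5) (by decide) (Sab := 72) (Sbc := 72)
    (Sca := 72) (by decide) (by decide) (by decide) (by decide)

/-- T_D: order 140 (planner's (‡) kill), shapes `(5,4,4),(4,5,4),(4,4,5),(4,4,4)`: impossible (`C`-form certificate). [original] -/
theorem noTD_140 {A B C : Fin 4 → Finset H} (h : IsSTPP A B C)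
    (hA : ∀ r, (A r).card = ![5, 4, 4, 4] r) (hB : ∀ r, (B r).card = ![4, 5, 4, 4] r)
    (hC : ∀ r, (C r).card = ![4, 4, 5, 4] r) (hM : Fintype.card H = 140) : False :=
  false_of_certificate_C h hA hB hC (by decide) hM (m := 5) (by decide) (Sab := 72) (Sbc := 72)
    (Sca := 72) (by decide) (by decide) (by decide) (by decide)

/-- T_D ceiling family: order 161, shapes `(5,5,4),(5,5,4),(4,4,5),(4,4,5)`: impossible (`C`-form certificate). [original] -/
theorem noTD_161 {A B C : Fin 4 → Finset H} (h : IsSTPP A B C)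
    (hA : ∀ r, (A r).card = ![5, 5, 4, 4] r) (hB : ∀ r, (B r).card = ![5, 5, 4, 4] r)
    (hC : ∀ r, (C r).card = ![4, 4, 5, 5] r) (hM : Fintype.card H = 161) : False :=
  false_of_certificate_C h hA hB hC (by decide) hM (m := 5) (by decide) (Sab := 82) (Sbc := 80)
    (Sca := 80) (by decide) (by decide) (by decide) (by decide)

/-- T_D ceiling family: order 162, shapes `(7,3,3),(4,5,5),(4,5,5),(4,5,5)`: impossible (`A`-form certificate). [original] -/
theorem noTD_162 {A B C : Fin 4 → Finset H} (h : IsSTPP A B C)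
    (hA : ∀ r, (A r).card = ![7, 4, 4, 4] r) (hB : ∀ r, (B r).card = ![3, 5, 5, 5] r)
    (hC : ∀ r, (C r).card = ![3, 5, 5, 5] r) (hM : Fintype.card H = 162) : False :=
  false_of_certificate_C h.rotate hB hC hA (by decide) hM (m := 7) (by decide) (Sab := 84) (Sbc := 81)
    (Sca := 81) (by decide) (by decide) (by decide) (by decide)

/-- T_D ceiling family: order 163, shapes `(7,3,3),(4,5,5),(4,5,5),(4,5,5)`: impossible (`C`-form certificate). [original] -/
theorem noTD_163 {A B C : Fin 4 → Finset H} (h : IsSTPP A B C)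
    (hA : ∀ r, (A r).card = ![7, 4, 4, 4] r) (hB : ∀ r, (B r).card = ![3, 5, 5, 5] r)
    (hC : ∀ r, (C r).card = ![3, 5, 5, 5] r) (hM : Fintype.card H = 163) : False :=
  false_of_certificate_C h hA hB hC (by decide) hM (m := 5) (by decide) (Sab := 81) (Sbc := 84)
    (Sca := 81) (by decide) (by decide) (by decide) (by decide)

/-- T_D ceiling family: order 164, shapes `(6,4,4),(6,4,4),(4,5,5),(3,5,5)`: impossible (`C`-form certificate). [original] -/
theorem noTD_164 {A B C : Fin 4 → Finset H} (h : IsSTPP A B C)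
    (hA : ∀ r, (A r).card = ![6, 6, 4, 3] r) (hB : ∀ r, (B r).card = ![4, 4, 5, 5] r)
    (hC : ∀ r, (C r).card = ![4, 4, 5, 5] r) (hM : Fintype.card H = 164) : False :=
  false_of_certificate_C h hA hB hC (by decide) hM (m := 5) (by decide) (Sab := 83) (Sbc := 82)
    (Sca := 83) (by decide) (by decide) (by decide) (by decide)

/-- T_D ceiling family: order 165, shapes `(8,3,3),(4,5,5),(4,5,5),(4,5,5)`: impossible (`C`-form certificate). [original] -/
theorem noTD_165 {A B C : Fin 4 → Finset H} (h : IsSTPP A B C)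
    (hA : ∀ r, (A r).card = ![8, 4, 4, 4] r) (hB : ∀ r, (B r).card = ![3, 5, 5, 5] r)
    (hC : ∀ r, (C r).card = ![3, 5, 5, 5] r) (hM : Fintype.card H = 165) : False :=
  false_of_certificate_C h hA hB hC (by decide) hM (m := 5) (by decide) (Sab := 84) (Sbc := 84)
    (Sca := 84) (by decide) (by decide) (by decide) (by decide)

/-- T_D ceiling family: order 166, shapes `(8,3,3),(4,5,5),(4,5,5),(4,5,5)`: impossible (`C`-form certificate). [original] -/
theorem noTD_166 {A B C : Fin 4 → Finset H} (h : IsSTPP A B C)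
    (hA : ∀ r, (A r).card = ![8, 4, 4, 4] r) (hB : ∀ r, (B r).card = ![3, 5, 5, 5] r)
    (hC : ∀ r, (C r).card = ![3, 5, 5, 5] r) (hM : Fintype.card H = 166) : False :=
  false_of_certificate_C h hA hB hC (by decide) hM (m := 5) (by decide) (Sab := 84) (Sbc := 84)
    (Sca := 84) (by decide) (by decide) (by decide) (by decide)

set_option maxRecDepth 100000 in
/-- T_B (τ = 2.375): order 450 (planner's §5 kill), shapes `(7,6,6),(6,7,6),(6,6,7),(6,6,6),(6,6,6),(6,6,6)`: impossible (`C`-form certificate). [original] -/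
theorem noTD_450 {A B C : Fin 6 → Finset H} (h : IsSTPP A B C)
    (hA : ∀ r, (A r).card = ![7, 6, 6, 6, 6, 6] r) (hB : ∀ r, (B r).card = ![6, 7, 6, 6, 6, 6] r)
    (hC : ∀ r, (C r).card = ![6, 6, 7, 6, 6, 6] r) (hM : Fintype.card H = 450) : False :=
  false_of_certificate_C h hA hB hC (by decide) hM (m := 7) (by decide) (Sab := 228) (Sbc := 228)
    (Sca := 228) (by decide) (by decide) (by decide) (by decide)

end STPPSlack

namespace AbelianTECensus

open Finset Literature.Computability.AlgebraicComplexity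

variable {H : Type*} [AddCommGroup H] {N : ℕ} {A B C : Fin N → Finset H}

/-- From `HasSubfamilyShapes A B C [x₀, …, x₅]`: a `Fin 6`-indexed STPP sub-family with exactly these
shapes. [bookkeeping] -/
theorem exists_six_of_hasSubfamilyShapes (h : IsSTPP A B C) {x₀ x₁ x₂ x₃ x₄ x₅ : ℕ × ℕ × ℕ}
    (hs : HasSubfamilyShapes A B C [x₀, x₁, x₂, x₃, x₄, x₅]) :
    ∃ A' B' C' : Fin 6 → Finset H, IsSTPP A' B' C' ∧
      (∀ r, (A' r).card = ![x₀.1, x₁.1, x₂.1, x₃.1, x₄.1, x₅.1] r) ∧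
      (∀ r, (B' r).card = ![x₀.2.1, x₁.2.1, x₂.2.1, x₃.2.1, x₄.2.1, x₅.2.1] r) ∧
      (∀ r, (C' r).card = ![x₀.2.2, x₁.2.2, x₂.2.2, x₃.2.2, x₄.2.2, x₅.2.2] r) := by
  obtain ⟨φ, hφ⟩ := hs
  have e : ∀ r : Fin 6, ((A (φ r)).card, (B (φ r)).card, (C (φ r)).card) =
      ![x₀, x₁, x₂, x₃, x₄, x₅] r := by
    intro r
    have := hφ r
    fin_cases r <;> exact this
  refine ⟨fun r => A (φ r), fun r => B (φ r), fun r => C (φ r),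
    h.comp_of_injective φ φ.injective, ?_, ?_, ?_⟩
  · intro r; have := congrArg Prod.fst (e r); fin_cases r <;> exact this
  · intro r; have := congrArg (fun p => p.2.1) (e r); fin_cases r <;> exact this
  · intro r; have := congrArg (fun p => p.2.2) (e r); fin_cases r <;> exact this

/-- Q3.13 (T_D, τ = 2.47): order 141: no STPP sub-family of shapes `[(5,4,4),(4,5,4),(4,4,5),(4,4,4)]` (abelian hosts). [original] -/
theorem noSTPPSubfamily_TD_141 : NoSTPPSubfamily 141 [(5,4,4),(4,5,4),(4,4,5),(4,4,4)] := by
  intro H _ _ hH N A B C h hs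
  obtain ⟨A', B', C', h', hA, hB, hC⟩ := exists_four_of_hasSubfamilyShapes h hs
  exact STPPSlack.noTD_141 h' hA hB hC hH

/-- T_D: order 140 (planner's (‡) kill): no STPP sub-family of shapes `[(5,4,4),(4,5,4),(4,4,5),(4,4,4)]` (abelian hosts). [original] -/
theorem noSTPPSubfamily_TD_140 : NoSTPPSubfamily 140 [(5,4,4),(4,5,4),(4,4,5),(4,4,4)] := by
  intro H _ _ hH N A B C h hs
  obtain ⟨A', B', C', h', hA, hB, hC⟩ := exists_four_of_hasSubfamilyShapes h hs
  exact STPPSlack.noTD_140 h' hA hB hC hH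

/-- T_D ceiling family: order 161: no STPP sub-family of shapes `[(5,5,4),(5,5,4),(4,4,5),(4,4,5)]` (abelian hosts). [original] -/
theorem noSTPPSubfamily_TD_161 : NoSTPPSubfamily 161 [(5,5,4),(5,5,4),(4,4,5),(4,4,5)] := by
  intro H _ _ hH N A B C h hs
  obtain ⟨A', B', C', h', hA, hB, hC⟩ := exists_four_of_hasSubfamilyShapes h hs
  exact STPPSlack.noTD_161 h' hA hB hC hH

/-- T_D ceiling family: order 162: no STPP sub-family of shapes `[(7,3,3),(4,5,5),(4,5,5),(4,5,5)]` (abelian hosts). [original] -/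
theorem noSTPPSubfamily_TD_162 : NoSTPPSubfamily 162 [(7,3,3),(4,5,5),(4,5,5),(4,5,5)] := by
  intro H _ _ hH N A B C h hs
  obtain ⟨A', B', C', h', hA, hB, hC⟩ := exists_four_of_hasSubfamilyShapes h hs
  exact STPPSlack.noTD_162 h' hA hB hC hH

/-- T_D ceiling family: order 163: no STPP sub-family of shapes `[(7,3,3),(4,5,5),(4,5,5),(4,5,5)]` (abelian hosts). [original] -/
theorem noSTPPSubfamily_TD_163 : NoSTPPSubfamily 163 [(7,3,3),(4,5,5),(4,5,5),(4,5,5)] := by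
  intro H _ _ hH N A B C h hs
  obtain ⟨A', B', C', h', hA, hB, hC⟩ := exists_four_of_hasSubfamilyShapes h hs
  exact STPPSlack.noTD_163 h' hA hB hC hH

/-- T_D ceiling family: order 164: no STPP sub-family of shapes `[(6,4,4),(6,4,4),(4,5,5),(3,5,5)]` (abelian hosts). [original] -/
theorem noSTPPSubfamily_TD_164 : NoSTPPSubfamily 164 [(6,4,4),(6,4,4),(4,5,5),(3,5,5)] := by
  intro H _ _ hH N A B C h hs
  obtain ⟨A', B', C', h', hA, hB, hC⟩ := exists_four_of_hasSubfamilyShapes h hs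
  exact STPPSlack.noTD_164 h' hA hB hC hH

/-- T_D ceiling family: order 165: no STPP sub-family of shapes `[(8,3,3),(4,5,5),(4,5,5),(4,5,5)]` (abelian hosts). [original] -/
theorem noSTPPSubfamily_TD_165 : NoSTPPSubfamily 165 [(8,3,3),(4,5,5),(4,5,5),(4,5,5)] := by
  intro H _ _ hH N A B C h hs
  obtain ⟨A', B', C', h', hA, hB, hC⟩ := exists_four_of_hasSubfamilyShapes h hs
  exact STPPSlack.noTD_165 h' hA hB hC hH

/-- T_D ceiling family: order 166: no STPP sub-family of shapes `[(8,3,3),(4,5,5),(4,5,5),(4,5,5)]` (abelian hosts). [original] -/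
theorem noSTPPSubfamily_TD_166 : NoSTPPSubfamily 166 [(8,3,3),(4,5,5),(4,5,5),(4,5,5)] := by
  intro H _ _ hH N A B C h hs
  obtain ⟨A', B', C', h', hA, hB, hC⟩ := exists_four_of_hasSubfamilyShapes h hs
  exact STPPSlack.noTD_166 h' hA hB hC hH

/-- T_B (τ = 2.375): order 450 (planner's §5 kill): no STPP sub-family of shapes `[(7,6,6),(6,7,6),(6,6,7),(6,6,6),(6,6,6),(6,6,6)]` (abelian hosts). [original] -/
theorem noSTPPSubfamily_TD_450 : NoSTPPSubfamily 450 [(7,6,6),(6,7,6),(6,6,7),(6,6,6),(6,6,6),(6,6,6)] := by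
  intro H _ _ hH N A B C h hs
  obtain ⟨A', B', C', h', hA, hB, hC⟩ := exists_six_of_hasSubfamilyShapes h hs
  exact STPPSlack.noTD_450 h' hA hB hC hH

end AbelianTECensus

end Summit.MatrixMultiplication.MatrixMultiplication.Theorems
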